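import Summits.CriticalPhenomena.PercolationContinuityZ3.Theorems.PercNearOneGluingNoHeavyLowerTailSunflowerMultiPetalSpectator
import HarnessLib
import HarnessLib.Audit

/-!
# `NoHeavyLowerTail` (crux stmt-CriticalPhenomena-4575), abstract sunflower cubic, `k` petals: POINTWISE KEYS for kernel demotion / bottom extension —
# `s6K d y z − s6K c y z ≥ 2·kkK y z` and the refined `≥ kkK y z + twK y z` (decided `d`, petal `c`), the double-empty values, flipped antipodal pairs

Support file (seat `prim-l12-p2` gen 32; `--supports stmt-CriticalPhenomena-4575`; companion of `…SunflowerMultiPetalSpectator` (p339016: `s6K_congr`, `kkK_congr`,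
`chart3`) and of the move files `…SunflowerMultiPetalDemotion` / `…SunflowerMultiPetalExtension` (this gen), which consume these lemmas).  Everything here is PROVED
(`Fin 5` cores by `decide`, general `k` by charting).  Memo: run/shared/lean/prim/prim-l12/prim-l12-p2/FINDING-g32.md §3.

* `chart_four` — the chart data for four labels `d` (decided), `c` (petal), `y`, `z` with anchors `(c, y)`.
* **`two_kkK_le_s6K_dec_sub_petal₁/₂/₃`**: `2·kkK y z ≤ s6K d y z − s6K c y z` in each block position (d ∈ {⊤, 0}, c a petal) — replacing a petal label by a decided
  label gains at least twice the antipodal-Gladkov kernel of the other two labels.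
* `twK` (the positive part of `kkK`), **`kkK_add_twK_le_s6K_dec_sub_petal₁/₂/₃`** (the refined key `kkK + twK ≤ …`), `s6K_dd_sub_cc₁/₂/₃` (`s6K d d w − s6K c c w = 2·twK d w`,
  the value on partitions with two blocks carrying the moved label), `kkK_add_twK_last_left/right`, `twK_last_comm`.
* `sum_powerset_flipPair` — after flipping by `D`, the two blocks complementary to `X` are an antipodal pair of `2^{Xᶜ}` with common offset `D ∩ X`
  (re-indexed by the involution `T ↦ T ∆ (D ∩ Xᶜ)`); `symmDiff_univ_eq_compl`, `symmDiff_compl_left`; `MSunflower.lab_eq_of_mem_iff`.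
-/

namespace Summit.CriticalPhenomena.PercolationContinuityZ3.Theorems.SunflowerPartition

open Finset

/-! ## The pointwise key: a decided label dominates a petal label by twice the Gladkov kernel -/

/-- `Fin 5` core of the key inequality, first block. [this work] -/
theorem two_kk_le_s6K_three_sub₁ : ∀ d c y z : Fin 5, (d = 4 ∨ d = 0) → c ≠ 0 → c ≠ 4 →
    2 * kkK 3 y z ≤ s6K 3 d y z - s6K 3 c y z := by decide

/-- `Fin 5` core of the key inequality, second block. [this work] -/
theorem two_kk_le_s6K_three_sub₂ : ∀ d c y z : Fin 5, (d = 4 ∨ d = 0) → c ≠ 0 → c ≠ 4 →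
    2 * kkK 3 y z ≤ s6K 3 y d z - s6K 3 y c z := by decide

/-- `Fin 5` core of the key inequality, third block. [this work] -/
theorem two_kk_le_s6K_three_sub₃ : ∀ d c y z : Fin 5, (d = 4 ∨ d = 0) → c ≠ 0 → c ≠ 4 →
    2 * kkK 3 y z ≤ s6K 3 y z d - s6K 3 y z c := by decide

/-- Chart data for the four labels `d` (decided), `c` (petal), `y`, `z` with anchors `(c, y)`: all the `iff`s needed by `s6K_congr` / `kkK_congr`. [this work] -/
theorem chart_four {k : ℕ} {d c : Fin (k + 2)} (hd : d = Fin.last (k + 1) ∨ d = 0) (hc0 : c ≠ 0) (hct : c ≠ Fin.last (k + 1)) (y z : Fin (k + 2)) :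
    let ch := chart3 k c y
    (d = Fin.last (k + 1) ↔ ch d = Fin.last (3 + 1)) ∧ (d = 0 ↔ ch d = 0) ∧
    (c = Fin.last (k + 1) ↔ ch c = Fin.last (3 + 1)) ∧ (c = 0 ↔ ch c = 0) ∧
    (y = Fin.last (k + 1) ↔ ch y = Fin.last (3 + 1)) ∧ (y = 0 ↔ ch y = 0) ∧
    (z = Fin.last (k + 1) ↔ ch z = Fin.last (3 + 1)) ∧ (z = 0 ↔ ch z = 0) ∧
    (d = y ↔ ch d = ch y) ∧ (d = z ↔ ch d = ch z) ∧ (y = z ↔ ch y = ch z) ∧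
    (c = y ↔ ch c = ch y) ∧ (c = z ↔ ch c = ch z) ∧ (y = d ↔ ch y = ch d) ∧ (z = d ↔ ch z = ch d) ∧
    (ch d = 4 ∨ ch d = 0) ∧ ch c ≠ 0 ∧ ch c ≠ 4 := by
  intro ch
  have e4 : (4 : Fin 5) = Fin.last (3 + 1) := rfl
  have ht : ∀ w, w = Fin.last (k + 1) ↔ ch w = Fin.last (3 + 1) := fun w => by
    rw [← e4]; exact (chart3_eq_four_iff k c y w).symm
  have h0 : ∀ w, w = 0 ↔ ch w = 0 := fun w => (chart3_eq_zero_iff k c y w).symm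
  have hcy : c = y ↔ ch c = ch y := chart3_eq_iff k c y (fun h _ => absurd rfl h.1)
  have hcz : c = z ↔ ch c = ch z := chart3_eq_iff k c y (fun h _ => absurd rfl h.1)
  have hyz : y = z ↔ ch y = ch z := chart3_eq_iff k c y (fun h _ => absurd rfl h.2)
  -- `d` is decided, so its chart value is `4` or `0`, and equalities with `d` are detected by the top/bottom iff's
  have hdval : ch d = 4 ∨ ch d = 0 := by
    rcases hd with h | h
    · exact Or.inl ((chart3_eq_four_iff k c y d).2 h)
    · exact Or.inr ((chart3_eq_zero_iff k c y d).2 h)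
  have hdw : ∀ w, d = w ↔ ch d = ch w := by
    intro w
    rcases hd with h | h
    · rw [h]
      constructor
      · rintro heq; rw [heq]
      · intro heq
        have h4 : ch (Fin.last (k + 1)) = 4 := (chart3_eq_four_iff k c y _).2 rfl
        rw [h4] at heq
        exact ((chart3_eq_four_iff k c y w).1 heq.symm).symm
    · rw [h]
      constructor
      · rintro heq; rw [heq]
      · intro heq
        have hz0 : ch 0 = 0 := (chart3_eq_zero_iff k c y _).2 rfl
        rw [hz0] at heq
        exact ((chart3_eq_zero_iff k c y w).1 heq.symm).symm
  refine ⟨ht d, h0 d, ht c, h0 c, ht y, h0 y, ht z, h0 z, hdw y, hdw z, hyz, hcy, hcz, ?_, ?_, hdval, ?_, ?_⟩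
  · rw [eq_comm, hdw y, eq_comm]
  · rw [eq_comm, hdw z, eq_comm]
  · exact fun h => hc0 ((h0 c).2 h)
  · intro h
    exact hct ((ht c).2 (by rw [h]; rfl))

/-- **Key inequality, first block**: `2·kkK y z ≤ s6K d y z − s6K c y z` for decided `d` and petal `c`. [this work] -/
theorem two_kkK_le_s6K_dec_sub_petal₁ {k : ℕ} {d c : Fin (k + 2)} (hd : d = Fin.last (k + 1) ∨ d = 0) (hc0 : c ≠ 0)
    (hct : c ≠ Fin.last (k + 1)) (y z : Fin (k + 2)) : 2 * kkK k y z ≤ s6K k d y z - s6K k c y z := by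
  obtain ⟨hdt, hd0, hct', hc0', hyt, hy0, hzt, hz0, hdy, hdz, hyz, hcy, hcz, _, _, hdval, hc1, hc2⟩ := chart_four hd hc0 hct y z
  rw [kkK_congr hyt hy0 hzt hz0 hyz, s6K_congr hdt hd0 hyt hy0 hzt hz0 hdy hyz hdz, s6K_congr hct' hc0' hyt hy0 hzt hz0 hcy hyz hcz]
  exact two_kk_le_s6K_three_sub₁ _ _ _ _ hdval hc1 hc2

/-- **Key inequality, second block**. [this work] -/
theorem two_kkK_le_s6K_dec_sub_petal₂ {k : ℕ} {d c : Fin (k + 2)} (hd : d = Fin.last (k + 1) ∨ d = 0) (hc0 : c ≠ 0)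
    (hct : c ≠ Fin.last (k + 1)) (y z : Fin (k + 2)) : 2 * kkK k y z ≤ s6K k y d z - s6K k y c z := by
  obtain ⟨hdt, hd0, hct', hc0', hyt, hy0, hzt, hz0, hdy, hdz, hyz, hcy, hcz, hyd, _, hdval, hc1, hc2⟩ := chart_four hd hc0 hct y z
  rw [kkK_congr hyt hy0 hzt hz0 hyz, s6K_congr hyt hy0 hdt hd0 hzt hz0 hyd hdz hyz,
    s6K_congr hyt hy0 hct' hc0' hzt hz0 (by rw [eq_comm, hcy, eq_comm]) hcz hyz]
  exact two_kk_le_s6K_three_sub₂ _ _ _ _ hdval hc1 hc2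

/-- **Key inequality, third block**. [this work] -/
theorem two_kkK_le_s6K_dec_sub_petal₃ {k : ℕ} {d c : Fin (k + 2)} (hd : d = Fin.last (k + 1) ∨ d = 0) (hc0 : c ≠ 0)
    (hct : c ≠ Fin.last (k + 1)) (y z : Fin (k + 2)) : 2 * kkK k y z ≤ s6K k y z d - s6K k y z c := by
  obtain ⟨hdt, hd0, hct', hc0', hyt, hy0, hzt, hz0, hdy, hdz, hyz, hcy, hcz, hyd, hzd, hdval, hc1, hc2⟩ := chart_four hd hc0 hct y z
  rw [kkK_congr hyt hy0 hzt hz0 hyz, s6K_congr hyt hy0 hzt hz0 hdt hd0 hyz hzd hyd,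
    s6K_congr hyt hy0 hzt hz0 hct' hc0' hyz (by rw [eq_comm, hcz, eq_comm]) (by rw [eq_comm, hcy, eq_comm])]
  exact two_kk_le_s6K_three_sub₃ _ _ _ _ hdval hc1 hc2


/-! ## Refined key and the double-empty values (for the corner `D = M`) -/

/-- Indicator of an ordered (top, bottom) or (bottom, top) pair — the positive part of `kkK`. [this work] -/
def twK (k : ℕ) (y z : Fin (k + 2)) : ℤ :=
  (if y = Fin.last (k + 1) ∧ z = 0 then 1 else 0) + (if y = 0 ∧ z = Fin.last (k + 1) then 1 else 0)

/-- `twK ≥ 0`. [this work] -/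
theorem twK_nonneg (k : ℕ) (y z : Fin (k + 2)) : 0 ≤ twK k y z := by
  unfold twK; split_ifs <;> norm_num

/-- Transport of `twK` along a top/bottom-preserving relabelling. [this work] -/
theorem twK_congr {k k' : ℕ} {y z : Fin (k + 2)} {y' z' : Fin (k' + 2)}
    (hyt : y = Fin.last (k + 1) ↔ y' = Fin.last (k' + 1)) (hy0 : y = 0 ↔ y' = 0)
    (hzt : z = Fin.last (k + 1) ↔ z' = Fin.last (k' + 1)) (hz0 : z = 0 ↔ z' = 0) : twK k y z = twK k' y' z' := by
  unfold twK
  rw [if_congr (and_congr hyt hz0) (Eq.refl (1 : ℤ)) (Eq.refl (0 : ℤ)), if_congr (and_congr hy0 hzt) (Eq.refl (1 : ℤ)) (Eq.refl (0 : ℤ))]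

/-- `Fin 5` cores of the refined key. [this work] -/
theorem kk_tw_le_s6K_three_sub₁ : ∀ d c y z : Fin 5, (d = 4 ∨ d = 0) → c ≠ 0 → c ≠ 4 →
    kkK 3 y z + twK 3 y z ≤ s6K 3 d y z - s6K 3 c y z := by decide
/-- `Fin 5` core of the refined key, second block. [this work] -/
theorem kk_tw_le_s6K_three_sub₂ : ∀ d c y z : Fin 5, (d = 4 ∨ d = 0) → c ≠ 0 → c ≠ 4 →
    kkK 3 y z + twK 3 y z ≤ s6K 3 y d z - s6K 3 y c z := by decide
/-- `Fin 5` core of the refined key, third block. [this work] -/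
theorem kk_tw_le_s6K_three_sub₃ : ∀ d c y z : Fin 5, (d = 4 ∨ d = 0) → c ≠ 0 → c ≠ 4 →
    kkK 3 y z + twK 3 y z ≤ s6K 3 y z d - s6K 3 y z c := by decide

/-- **Refined key, first block**: `kkK y z + twK y z ≤ s6K d y z − s6K c y z`. [this work] -/
theorem kkK_add_twK_le_s6K_dec_sub_petal₁ {k : ℕ} {d c : Fin (k + 2)} (hd : d = Fin.last (k + 1) ∨ d = 0) (hc0 : c ≠ 0)
    (hct : c ≠ Fin.last (k + 1)) (y z : Fin (k + 2)) : kkK k y z + twK k y z ≤ s6K k d y z - s6K k c y z := by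
  obtain ⟨hdt, hd0, hct', hc0', hyt, hy0, hzt, hz0, hdy, hdz, hyz, hcy, hcz, _, _, hdval, hc1, hc2⟩ := chart_four hd hc0 hct y z
  rw [kkK_congr hyt hy0 hzt hz0 hyz, twK_congr hyt hy0 hzt hz0, s6K_congr hdt hd0 hyt hy0 hzt hz0 hdy hyz hdz,
    s6K_congr hct' hc0' hyt hy0 hzt hz0 hcy hyz hcz]
  exact kk_tw_le_s6K_three_sub₁ _ _ _ _ hdval hc1 hc2

/-- Refined key, second block. [this work] -/
theorem kkK_add_twK_le_s6K_dec_sub_petal₂ {k : ℕ} {d c : Fin (k + 2)} (hd : d = Fin.last (k + 1) ∨ d = 0) (hc0 : c ≠ 0)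
    (hct : c ≠ Fin.last (k + 1)) (y z : Fin (k + 2)) : kkK k y z + twK k y z ≤ s6K k y d z - s6K k y c z := by
  obtain ⟨hdt, hd0, hct', hc0', hyt, hy0, hzt, hz0, hdy, hdz, hyz, hcy, hcz, hyd, _, hdval, hc1, hc2⟩ := chart_four hd hc0 hct y z
  rw [kkK_congr hyt hy0 hzt hz0 hyz, twK_congr hyt hy0 hzt hz0, s6K_congr hyt hy0 hdt hd0 hzt hz0 hyd hdz hyz,
    s6K_congr hyt hy0 hct' hc0' hzt hz0 (by rw [eq_comm, hcy, eq_comm]) hcz hyz]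
  exact kk_tw_le_s6K_three_sub₂ _ _ _ _ hdval hc1 hc2

/-- Refined key, third block. [this work] -/
theorem kkK_add_twK_le_s6K_dec_sub_petal₃ {k : ℕ} {d c : Fin (k + 2)} (hd : d = Fin.last (k + 1) ∨ d = 0) (hc0 : c ≠ 0)
    (hct : c ≠ Fin.last (k + 1)) (y z : Fin (k + 2)) : kkK k y z + twK k y z ≤ s6K k y z d - s6K k y z c := by
  obtain ⟨hdt, hd0, hct', hc0', hyt, hy0, hzt, hz0, hdy, hdz, hyz, hcy, hcz, hyd, hzd, hdval, hc1, hc2⟩ := chart_four hd hc0 hct y z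
  rw [kkK_congr hyt hy0 hzt hz0 hyz, twK_congr hyt hy0 hzt hz0, s6K_congr hyt hy0 hzt hz0 hdt hd0 hyz hzd hyd,
    s6K_congr hyt hy0 hzt hz0 hct' hc0' hyz (by rw [eq_comm, hcz, eq_comm]) (by rw [eq_comm, hcy, eq_comm])]
  exact kk_tw_le_s6K_three_sub₃ _ _ _ _ hdval hc1 hc2

/-- `Fin 5` cores of the double-empty values. [this work] -/
theorem s6K_three_dd_sub_cc₁ : ∀ d c w : Fin 5, (d = 4 ∨ d = 0) → c ≠ 0 → c ≠ 4 → s6K 3 d d w - s6K 3 c c w = 2 * twK 3 d w := by decide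
/-- `Fin 5` core of the double-empty value, positions (1,3). [this work] -/
theorem s6K_three_dd_sub_cc₂ : ∀ d c w : Fin 5, (d = 4 ∨ d = 0) → c ≠ 0 → c ≠ 4 → s6K 3 d w d - s6K 3 c w c = 2 * twK 3 d w := by decide
/-- `Fin 5` core of the double-empty value, positions (2,3). [this work] -/
theorem s6K_three_dd_sub_cc₃ : ∀ d c w : Fin 5, (d = 4 ∨ d = 0) → c ≠ 0 → c ≠ 4 → s6K 3 w d d - s6K 3 w c c = 2 * twK 3 d w := by decide

/-- Double-empty value, positions (1,2): `s6K d d w − s6K c c w = 2·twK d w`. [this work] -/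
theorem s6K_dd_sub_cc₁ {k : ℕ} {d c : Fin (k + 2)} (hd : d = Fin.last (k + 1) ∨ d = 0) (hc0 : c ≠ 0) (hct : c ≠ Fin.last (k + 1))
    (w : Fin (k + 2)) : s6K k d d w - s6K k c c w = 2 * twK k d w := by
  obtain ⟨hdt, hd0, hct', hc0', _, _, hwt, hw0, _, hdw, _, _, hcw, _, _, hdval, hc1, hc2⟩ := chart_four hd hc0 hct w w
  have hdd : d = d ↔ chart3 k c w d = chart3 k c w d := ⟨fun _ => rfl, fun _ => rfl⟩
  have hcc : c = c ↔ chart3 k c w c = chart3 k c w c := ⟨fun _ => rfl, fun _ => rfl⟩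
  rw [s6K_congr hdt hd0 hdt hd0 hwt hw0 hdd hdw hdw, s6K_congr hct' hc0' hct' hc0' hwt hw0 hcc hcw hcw, twK_congr hdt hd0 hwt hw0]
  exact s6K_three_dd_sub_cc₁ _ _ _ hdval hc1 hc2

/-- Double-empty value, positions (1,3). [this work] -/
theorem s6K_dd_sub_cc₂ {k : ℕ} {d c : Fin (k + 2)} (hd : d = Fin.last (k + 1) ∨ d = 0) (hc0 : c ≠ 0) (hct : c ≠ Fin.last (k + 1))
    (w : Fin (k + 2)) : s6K k d w d - s6K k c w c = 2 * twK k d w := by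
  obtain ⟨hdt, hd0, hct', hc0', _, _, hwt, hw0, _, hdw, _, _, hcw, _, hwd, hdval, hc1, hc2⟩ := chart_four hd hc0 hct w w
  have hdd : d = d ↔ chart3 k c w d = chart3 k c w d := ⟨fun _ => rfl, fun _ => rfl⟩
  have hcc : c = c ↔ chart3 k c w c = chart3 k c w c := ⟨fun _ => rfl, fun _ => rfl⟩
  rw [s6K_congr hdt hd0 hwt hw0 hdt hd0 hdw hwd hdd, s6K_congr hct' hc0' hwt hw0 hct' hc0' hcw (by rw [eq_comm, hcw, eq_comm]) hcc,
    twK_congr hdt hd0 hwt hw0]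
  exact s6K_three_dd_sub_cc₂ _ _ _ hdval hc1 hc2

/-- Double-empty value, positions (2,3). [this work] -/
theorem s6K_dd_sub_cc₃ {k : ℕ} {d c : Fin (k + 2)} (hd : d = Fin.last (k + 1) ∨ d = 0) (hc0 : c ≠ 0) (hct : c ≠ Fin.last (k + 1))
    (w : Fin (k + 2)) : s6K k w d d - s6K k w c c = 2 * twK k d w := by
  obtain ⟨hdt, hd0, hct', hc0', _, _, hwt, hw0, _, _, _, _, hcw, _, hwd, hdval, hc1, hc2⟩ := chart_four hd hc0 hct w w
  have hdd : d = d ↔ chart3 k c w d = chart3 k c w d := ⟨fun _ => rfl, fun _ => rfl⟩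
  have hcc : c = c ↔ chart3 k c w c = chart3 k c w c := ⟨fun _ => rfl, fun _ => rfl⟩
  rw [s6K_congr hwt hw0 hdt hd0 hdt hd0 hwd hdd hwd, s6K_congr hwt hw0 hct' hc0' hct' hc0' (by rw [eq_comm, hcw, eq_comm]) hcc (by rw [eq_comm, hcw, eq_comm]),
    twK_congr hdt hd0 hwt hw0]
  exact s6K_three_dd_sub_cc₃ _ _ _ hdval hc1 hc2

variable {α : Type*} [DecidableEq α]

/-! ## Flipped antipodal pairs: the two blocks complementary to `X`, flipped by `D`, are an antipodal pair of `2^{Xᶜ}` with offset `D ∩ X` -/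

/-- For `T ⊆ W`: `T ∆ D = (D ∖ W) ∪ (T ∆ (D ∩ W))` (private copy of the `…FlipSlot` lemma). -/
private theorem symmDiff_eq_offset_unionP {T W : Finset α} (D : Finset α) (hT : T ⊆ W) :
    symmDiff T D = (D \ W) ∪ symmDiff T (D ∩ W) := by
  ext x
  have hx : x ∈ T → x ∈ W := fun h => hT h
  simp only [mem_symmDiff, mem_union, mem_sdiff, mem_inter]
  tauto

/-- For `T ⊆ W`: `(W ∖ T) ∆ D = (D ∖ W) ∪ (W ∖ (T ∆ (D ∩ W)))` (private copy of the `…FlipSlot` lemma). -/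
private theorem sdiff_symmDiff_eq_offset_unionP {T W : Finset α} (D : Finset α) (hT : T ⊆ W) :
    symmDiff (W \ T) D = (D \ W) ∪ (W \ symmDiff T (D ∩ W)) := by
  ext x
  have hx : x ∈ T → x ∈ W := fun h => hT h
  simp only [mem_symmDiff, mem_union, mem_sdiff, mem_inter]
  tauto

/-- **Flipped antipodal pairs** (`α` finite): for any function `g` of two labels... of two SETS,
`Σ_{T ⊆ Xᶜ} g (T ∆ D) ((X ∪ T)ᶜ ∆ D) = Σ_{T ⊆ Xᶜ} g ((D ∩ X) ∪ T) ((D ∩ X) ∪ (Xᶜ ∖ T))`. [this work] -/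
theorem sum_powerset_flipPair [Fintype α] (X D : Finset α) (g : Finset α → Finset α → ℤ) :
    ∑ T ∈ (Xᶜ).powerset, g (symmDiff T D) (symmDiff (X ∪ T)ᶜ D)
      = ∑ T ∈ (Xᶜ).powerset, g ((D ∩ X) ∪ T) ((D ∩ X) ∪ (Xᶜ \ T)) := by
  have hDX : D \ Xᶜ = D ∩ X := by
    ext x; simp only [mem_sdiff, mem_compl, not_not, mem_inter]
  have hterm : ∀ T ∈ (Xᶜ).powerset,
      g (symmDiff T D) (symmDiff (X ∪ T)ᶜ D) = g ((D ∩ X) ∪ symmDiff T (D ∩ Xᶜ)) ((D ∩ X) ∪ (Xᶜ \ symmDiff T (D ∩ Xᶜ))) := by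
    intro T hT
    have hTX : T ⊆ Xᶜ := mem_powerset.1 hT
    have hc : (X ∪ T)ᶜ = Xᶜ \ T := by rw [compl_union, sdiff_eq_inter_compl]
    rw [hc, symmDiff_eq_offset_unionP D hTX, sdiff_symmDiff_eq_offset_unionP D hTX, hDX]
  rw [sum_congr rfl hterm]
  refine sum_nbij' (fun T => symmDiff T (D ∩ Xᶜ)) (fun T => symmDiff T (D ∩ Xᶜ)) ?_ ?_ ?_ ?_ ?_
  · intro T hT
    exact mem_powerset.2 (symmDiff_subset_union.trans (union_subset (mem_powerset.1 hT) inter_subset_right))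
  · intro T hT
    exact mem_powerset.2 (symmDiff_subset_union.trans (union_subset (mem_powerset.1 hT) inter_subset_right))
  · intro T _; exact symmDiff_symmDiff_cancel_right _ _
  · intro T _; exact symmDiff_symmDiff_cancel_right _ _
  · intro T _; rfl

section CornerValues

variable {k : ℕ}

/-- `kkK ⊤ w + twK ⊤ w = 2·twK ⊤ w` (both sides are `2·[w = 0]`). [this work] -/
theorem kkK_add_twK_last_left (w : Fin (k + 2)) :
    kkK k (Fin.last (k + 1)) w + twK k (Fin.last (k + 1)) w = 2 * twK k (Fin.last (k + 1)) w := by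
  have hlt : (Fin.last (k + 1) : Fin (k + 2)) ≠ 0 := by
    intro h; have := congrArg Fin.val h; simp at this
  unfold kkK twK
  simp only [hlt, false_and, if_false, ne_eq, not_true_eq_false, true_and, add_zero]
  split_ifs <;> omega

/-- `kkK w ⊤ + twK w ⊤ = 2·twK ⊤ w`. [this work] -/
theorem kkK_add_twK_last_right (w : Fin (k + 2)) :
    kkK k w (Fin.last (k + 1)) + twK k w (Fin.last (k + 1)) = 2 * twK k (Fin.last (k + 1)) w := by
  have hlt : (Fin.last (k + 1) : Fin (k + 2)) ≠ 0 := by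
    intro h; have := congrArg Fin.val h; simp at this
  unfold kkK twK
  simp only [hlt, and_false, false_and, if_false, ne_eq, not_true_eq_false, and_true, true_and, zero_add, add_zero]
  split_ifs <;> omega

/-- `twK w ⊤ = twK ⊤ w`. [this work] -/
theorem twK_last_comm (w : Fin (k + 2)) : twK k w (Fin.last (k + 1)) = twK k (Fin.last (k + 1)) w := by
  have hlt : (Fin.last (k + 1) : Fin (k + 2)) ≠ 0 := by
    intro h; have := congrArg Fin.val h; simp at this
  unfold twK
  simp only [hlt, and_false, false_and, if_false, and_true, true_and, zero_add, add_zero]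

/-- `symmDiff univ M = Mᶜ`. [this work] -/
theorem symmDiff_univ_eq_compl [Fintype α] (M : Finset α) : symmDiff (univ : Finset α) M = Mᶜ := by
  ext x; simp [mem_symmDiff]

/-- `symmDiff Tᶜ M = (symmDiff T M)ᶜ`. [this work] -/
theorem symmDiff_compl_left [Fintype α] (T M : Finset α) : symmDiff Tᶜ M = (symmDiff T M)ᶜ := by
  ext x; simp only [mem_symmDiff, mem_compl]; tauto

end CornerValues

namespace MSunflower

variable {k : ℕ} (F : MSunflower k α)

/-! ## Labels are determined by the memberships -/

/-- Two structures that agree on the memberships of a set `S` give it the same label. [this work] -/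
theorem lab_eq_of_mem_iff {G : MSunflower k α} {S : Finset α} (hA : S ∈ F.A ↔ S ∈ G.A) (hV : ∀ i, S ∈ F.V i ↔ S ∈ G.V i) :
    F.lab S = G.lab S := by
  rcases F.lab_cases S with h | h | ⟨i, hSA, hSV, hl⟩
  · rw [(F.lab_eq_last_iff S).2 h, (G.lab_eq_last_iff S).2 (hA.1 h)]
  · rw [h]
    have h' := (F.lab_eq_zero_iff S).1 h
    exact ((G.lab_eq_zero_iff S).2 ⟨fun hh => h'.1 (hA.2 hh), fun i hh => h'.2 i ((hV i).2 hh)⟩).symm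
  · rw [hl]
    exact (G.lab_eq_petalLab (fun hh => hSA (hA.2 hh)) ((hV i).1 hSV)).symm

end MSunflower

end Summit.CriticalPhenomena.PercolationContinuityZ3.Theorems.SunflowerPartition
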